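import Summits.QuantumFields.BalabanUV.Beta.EriceRemainderEnclosureSegmentNormalFamily
import Summits.QuantumFields.BalabanUV.Beta.EriceFlowEnclosureUniformClause

/-!
# Beta / EriceFlowEnclosureSmoothClauseCalc — THE SMOOTH ROAD (S), PURE SERVICE: a family of C^∞ functions on a closed interval with
# ONE bound per derivative order and a pointwise limit HAS A LIMIT TOWER — every derivative sequence converges uniformly, the limits
# differentiate into each other within the CLOSED interval, inherit the bounds and the Lipschitz constants, and obey Taylor–Lagrange
# at every order with the family's constants
# (β-flow team, prover 2 = lower ∕ positivity side, unit `b2b-balaban-beta-bflow-p2`, gen 24; the calculus behind P2 #41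
# `EriceFlowEnclosureSmoothClause`, which reads [Balaban1987RG1] p. 264's MAIN clause «smooth … uniformly bounded on this interval
# together with all derivatives» where the lineage's analytic road (H) read its parenthesis «(or analytic)»)

HONEST FRAMING (page 1 of everything the β sub-cell writes): discharging `BetaPertH` makes Bałaban's UV stability UNCONDITIONAL — a
real constructive-QFT result; it is NOT the continuum limit and NOT the Clay problem.  HONEST DEPENDENCY (cell reorg 2026-08-19,
verbatim): «continuum YM on T⁴ ⇐ BetaPertH ∧ nine spine estimates (0/9 proved); BetaPertH ⇐ (D1) ∧ (D4) ∧ CAP+tail; G-an2-4 gates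
asym, D1 and NE2/3/4.»  THIS MODULE DISCHARGES NOTHING of that: it is [folklore] one-variable real analysis on a closed interval
`[a, b]` with NO Erice letter in it — the `C^k`-within-`[a, b]` dictionary (`iteratedDerivWithin`), the mean value inequality, d4-p2's
(E19a) NORMAL-FAMILY ENGINE `EriceRemainderEnclosureSegmentNormalFamily.allOrders_limit` BY NAME (uniform convergence climbs the
orders by the Landau–Kolmogorov interpolation inequality — THEIR theorem, general constants `A m`, not re-declared here), the
convergence half of Arzelà–Ascoli for an equi-Lipschitz family (bflow-p1 #9 `tendstoUniformlyOn_Icc_of_equiLipschitz`) and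
Taylor–Lagrange (`taylor_mean_remainder_bound`); P2 #41 applies it to the Markov family `S.βE`.

THE POINT.  On the analytic road (H) the derivative tower of the limit β (d4-p2's (E19) `allOrders_of_holoNhd_tendsto`, P2 #37e
`taylorAll_of_holoNhd`) came from Cauchy's estimate on a complex neighbourhood, fed into (E19a) with `u n m := Re F_n^{(m)}` and
`A m := m!·M∕ρ^m`.  On the smooth road (S) the data are: `f n` is `C^m` on `[a, b]` for every m, `|∂^m f n| ≤ Mb m` on `[a, b]`
(derivatives WITHIN the closed interval; ONE constant per order, uniform in n) and `f n → g` POINTWISE.  Feeding (E19a) with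
`u n m := ∂^m f n` (within `[a, b]`) and `A := Mb` — the dictionary of §1 says this IS a normal family in (E19a)'s sense, and the
order-zero uniform convergence is equi-Lipschitz + pointwise (bflow-p1 #9) — gives (§2 `smoothTower`) `D : ℕ → ℝ → ℝ` with `D 0 = g`,
`∂^m f n → D m` UNIFORMLY on `[a, b]` for EVERY m, `|D m| ≤ Mb m`, the quadratic Taylor bound with `Mb (m+2)`,
`HasDerivWithinAt (D m) (D (m+1) x) (Icc a b) x` on the CLOSED interval, `D m` `Mb (m+1)`-Lipschitz; and (§3 `taylor_of_smoothTower`)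
`|D k t − Σ_{m ≤ N} D (k+m) a·(t − a)^m∕m!| ≤ (Mb (k+N+1)∕N!)·(t − a)^{N+1}` on `[a, b]` for EVERY N and k — Taylor–Lagrange on each
`∂^k f n`, passed to the limit termwise.  The factorial shape `m!·M∕ρ^m` of road (H) is the special case that characterises the
analytic class; nothing here asks it.  STATUS: [folklore]; 0 def, 0 sorry; no Erice ∕ [I] sentence is used or asserted here.

WHAT THIS FILE PROVES:
§1 `hasDerivWithinAt_iteratedDerivWithin` (`∂^m f` has derivative `∂^{m+1} f` within `[a, b]` at every point of the closed interval),
   `contDiffOn_iteratedDerivWithin` (`∂^k` of a `C^{k+N}` function is `C^N`), `iteratedDerivWithin_iteratedDerivWithin`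
   (`∂^j ∂^k = ∂^{k+j}` within a set), **`lipschitz_iteratedDerivWithin_of_succ_bound`** (`|∂^{m+1} f| ≤ B` ⟹ `∂^m f` B-Lipschitz).
§2 **`smoothTower`** (the limit tower of a `C^∞`-bounded pointwise-convergent family on `[a, b]`, via (E19a) BY NAME).
§3 **`taylor_of_smoothTower`** (Taylor–Lagrange to the limit at every order, explicit constants `Mb (k+N+1)∕N!`).
-/

namespace Summit.QuantumFields.BalabanUV.Beta.EriceFlowEnclosureSmoothClauseCalc

open Filter Set Metric
open scoped Topology Nat
open Summit.QuantumFields.BalabanUV.Beta.EriceFlowEnclosureUniformClause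
  (tendstoUniformlyOn_Icc_of_equiLipschitz lipschitz_lim_of_equiLipschitz)
open Summit.QuantumFields.BalabanUV.Beta.EriceRemainderEnclosureSegmentNormalFamily (allOrders_limit)

noncomputable section

/-! ## §1 Iterated derivatives within a closed interval: derivative, smoothness, composition, Lipschitz bound -/

/-- On `[a, b]` (`a < b`) a `C^{m+1}` function's m-th derivative within the interval has derivative the (m+1)-th derivative within
the interval, at every point of the CLOSED interval. [folklore] -/
theorem hasDerivWithinAt_iteratedDerivWithin {f : ℝ → ℝ} {a b : ℝ} {m : ℕ} (hab : a < b)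
    (hf : ContDiffOn ℝ (m + 1 : ℕ) f (Icc a b)) :
    ∀ x ∈ Icc a b, HasDerivWithinAt (iteratedDerivWithin m f (Icc a b))
      (iteratedDerivWithin (m + 1) f (Icc a b) x) (Icc a b) x := by
  intro x hx
  have hdiff : DifferentiableOn ℝ (iteratedDerivWithin m f (Icc a b)) (Icc a b) :=
    hf.differentiableOn_iteratedDerivWithin (by exact_mod_cast Nat.lt_succ_self m) (uniqueDiffOn_Icc hab)
  have h := (hdiff x hx).hasDerivWithinAt
  have e : derivWithin (iteratedDerivWithin m f (Icc a b)) (Icc a b) x = iteratedDerivWithin (m + 1) f (Icc a b) x := by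
    rw [iteratedDerivWithin_succ]
  rw [e] at h
  exact h

/-- On `[a, b]` (`a < b`) the k-th derivative within the interval of a `C^{k+N}` function is `C^N`. [folklore] -/
theorem contDiffOn_iteratedDerivWithin {a b : ℝ} (hab : a < b) (k : ℕ) :
    ∀ {N : ℕ} {f : ℝ → ℝ}, ContDiffOn ℝ (k + N : ℕ) f (Icc a b) → ContDiffOn ℝ N (iteratedDerivWithin k f (Icc a b)) (Icc a b) := by
  induction k with
  | zero =>
    intro N f hf
    rw [iteratedDerivWithin_zero]
    simpa using hf
  | succ k ih =>
    intro N f hf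
    rw [iteratedDerivWithin_succ']
    refine ih ?_
    refine hf.derivWithin (uniqueDiffOn_Icc hab) ?_
    exact_mod_cast (by omega : k + N + 1 ≤ k + 1 + N)

/-- Iterated derivatives within a set compose additively: `∂^j (∂^k f) = ∂^{k+j} f` (within `s`, pointwise). [folklore] -/
theorem iteratedDerivWithin_iteratedDerivWithin {f : ℝ → ℝ} {s : Set ℝ} (j k : ℕ) (x : ℝ) :
    iteratedDerivWithin j (iteratedDerivWithin k f s) s x = iteratedDerivWithin (k + j) f s x := by
  have e : iteratedDerivWithin k f s = (fun g : ℝ → ℝ => derivWithin g s)^[k] f := by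
    funext y; exact iteratedDerivWithin_eq_iterate
  rw [e, iteratedDerivWithin_eq_iterate, iteratedDerivWithin_eq_iterate, Nat.add_comm,
    Function.iterate_add_apply]

/-- **A bound on the next derivative is a Lipschitz constant**: if `f` is `C^{m+1}` on `[a, b]` (`a < b`) and
`|∂^{m+1} f| ≤ B` on `[a, b]` (derivatives within the interval), then `∂^m f` is B-Lipschitz on `[a, b]` (mean value inequality on
the convex interval). [folklore] -/
theorem lipschitz_iteratedDerivWithin_of_succ_bound {f : ℝ → ℝ} {a b B : ℝ} {m : ℕ} (hab : a < b)
    (hf : ContDiffOn ℝ (m + 1 : ℕ) f (Icc a b))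
    (hB : ∀ x ∈ Icc a b, |iteratedDerivWithin (m + 1) f (Icc a b) x| ≤ B) :
    ∀ x ∈ Icc a b, ∀ y ∈ Icc a b,
      |iteratedDerivWithin m f (Icc a b) x - iteratedDerivWithin m f (Icc a b) y| ≤ B * |x - y| := by
  intro x hx y hy
  have key := (convex_Icc a b).norm_image_sub_le_of_norm_hasDerivWithin_le
    (hasDerivWithinAt_iteratedDerivWithin hab hf) (fun z hz => by rw [Real.norm_eq_abs]; exact hB z hz) hy hx
  rw [Real.norm_eq_abs, Real.norm_eq_abs] at key
  exact key

/-! ## §2 The limit tower of a C^∞-bounded convergent family ((E19a)'s engine on the `C^k`-within dictionary) -/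

/-- **THE LIMIT TOWER ON THE SMOOTH ROAD.**  On `[a, b]` (`a < b`): let `f n` be `C^m` on `[a, b]` for every m with
`|∂^m f n| ≤ Mb m` on `[a, b]` (derivatives within the interval; ONE constant per order, uniform in n), and let `f n → g` POINTWISE on
`[a, b]`.  Then there is `D : ℕ → ℝ → ℝ` with: `D 0 = g` on `[a, b]`; `∂^m f n → D m` UNIFORMLY on `[a, b]` for every m;
`|D m| ≤ Mb m`; the quadratic Taylor bound `|D m y − D m x − (y − x)·D (m+1) x| ≤ Mb (m+2)·|y − x|²`;
`HasDerivWithinAt (D m) (D (m+1) x) (Icc a b) x` at every `x ∈ [a, b]`; `D m` is `Mb (m+1)`-Lipschitz on `[a, b]`.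
ROUTE: `u n m := ∂^m f n` within `[a, b]` is a normal family in the sense of d4-p2's (E19a) (§1 `hasDerivWithinAt_iteratedDerivWithin`
+ the bounds); its order-zero uniform convergence is equi-Lipschitz (`Mb 1`, §1) + pointwise (bflow-p1 #9
`tendstoUniformlyOn_Icc_of_equiLipschitz`); (E19a) `allOrders_limit` BY NAME gives the tower; the Lipschitz constants pass to the
limit (bflow-p1 #9 `lipschitz_lim_of_equiLipschitz`). [folklore] -/
theorem smoothTower {f : ℕ → ℝ → ℝ} {g : ℝ → ℝ} {a b : ℝ} {Mb : ℕ → ℝ} (hab : a < b)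
    (hsm : ∀ n m : ℕ, ContDiffOn ℝ m (f n) (Icc a b))
    (hbd : ∀ n m : ℕ, ∀ x ∈ Icc a b, |iteratedDerivWithin m (f n) (Icc a b) x| ≤ Mb m)
    (hpt : ∀ x ∈ Icc a b, Tendsto (fun n => f n x) atTop (𝓝 (g x))) :
    ∃ D : ℕ → ℝ → ℝ, (∀ x ∈ Icc a b, D 0 x = g x) ∧
      (∀ m, TendstoUniformlyOn (fun n => iteratedDerivWithin m (f n) (Icc a b)) (D m) atTop (Icc a b)) ∧
      (∀ m, ∀ x ∈ Icc a b, |D m x| ≤ Mb m) ∧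
      (∀ m, ∀ x ∈ Icc a b, ∀ y ∈ Icc a b, |D m y - D m x - (y - x) * D (m + 1) x| ≤ Mb (m + 2) * |y - x| ^ 2) ∧
      (∀ m, ∀ x ∈ Icc a b, HasDerivWithinAt (D m) (D (m + 1) x) (Icc a b) x) ∧
      (∀ m, ∀ x ∈ Icc a b, ∀ y ∈ Icc a b, |D m x - D m y| ≤ Mb (m + 1) * |x - y|) := by
  -- the `C^k`-within dictionary: (∂^m f n)_m is a normal family in (E19a)'s sense
  have hder : ∀ n m, ∀ x ∈ Icc a b, HasDerivWithinAt (iteratedDerivWithin m (f n) (Icc a b))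
      (iteratedDerivWithin (m + 1) (f n) (Icc a b) x) (Icc a b) x :=
    fun n m => hasDerivWithinAt_iteratedDerivWithin hab (hsm n (m + 1))
  have hlip : ∀ n m, ∀ x ∈ Icc a b, ∀ y ∈ Icc a b,
      |iteratedDerivWithin m (f n) (Icc a b) x - iteratedDerivWithin m (f n) (Icc a b) y| ≤ Mb (m + 1) * |x - y| :=
    fun n m => lipschitz_iteratedDerivWithin_of_succ_bound hab (hsm n (m + 1)) (hbd n (m + 1))
  -- order zero: equi-Lipschitz + pointwise ⟹ uniform (bflow-p1 #9)
  have h0 : TendstoUniformlyOn (fun n => iteratedDerivWithin 0 (f n) (Icc a b)) g atTop (Icc a b) := by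
    simp only [iteratedDerivWithin_zero]
    refine tendstoUniformlyOn_Icc_of_equiLipschitz (L := Mb 1) (fun n x hx y hy => ?_) hpt
    simpa using hlip n 0 x hx y hy
  -- (E19a) BY NAME
  obtain ⟨D, hD0, hTU, hDA, hDT, hDd⟩ :=
    allOrders_limit (u := fun n m => iteratedDerivWithin m (f n) (Icc a b)) (A := Mb) hder hbd hab h0
  refine ⟨D, hD0, hTU, hDA, hDT, hDd, fun m => ?_⟩
  exact lipschitz_lim_of_equiLipschitz (fun n => hlip n m) (fun x hx => (hTU m).tendsto_at hx)

/-! ## §3 Taylor–Lagrange to the limit, every order, explicit constants -/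

/-- **TAYLOR AT EVERY ORDER FOR THE LIMIT TOWER.**  Same family as `smoothTower`; if `∂^m f n x → D m x` for every m and every
`x ∈ [a, b]` (the tower's pointwise convergence), then for every N and k and every `t ∈ [a, b]`:
`|D k t − Σ_{m ≤ N} D (k+m) a·(t − a)^m∕m!| ≤ (Mb (k+N+1)∕N!)·(t − a)^{N+1}` — Taylor–Lagrange (`taylor_mean_remainder_bound`) for
`∂^k f n` (a `C^{N+1}` function whose (N+1)-th derivative is `∂^{k+N+1} f n`, bounded by `Mb (k+N+1)`), passed to the limit n → ∞
term by term. [folklore] -/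
theorem taylor_of_smoothTower {f : ℕ → ℝ → ℝ} {a b : ℝ} {Mb : ℕ → ℝ} (hab : a < b)
    (hsm : ∀ n m : ℕ, ContDiffOn ℝ m (f n) (Icc a b))
    (hbd : ∀ n m : ℕ, ∀ x ∈ Icc a b, |iteratedDerivWithin m (f n) (Icc a b) x| ≤ Mb m)
    {D : ℕ → ℝ → ℝ}
    (hDlim : ∀ m, ∀ x ∈ Icc a b, Tendsto (fun n => iteratedDerivWithin m (f n) (Icc a b) x) atTop (𝓝 (D m x)))
    (N k : ℕ) :
    ∀ t ∈ Icc a b, |D k t - ∑ m ∈ Finset.range (N + 1), D (k + m) a * (t - a) ^ m / m !|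
      ≤ Mb (k + N + 1) / N ! * (t - a) ^ (N + 1) := by
  intro t ht
  have ha : a ∈ Icc a b := ⟨le_rfl, hab.le⟩
  have key : ∀ n, |iteratedDerivWithin k (f n) (Icc a b) t
      - ∑ m ∈ Finset.range (N + 1), iteratedDerivWithin (k + m) (f n) (Icc a b) a * (t - a) ^ m / m !|
      ≤ Mb (k + N + 1) / N ! * (t - a) ^ (N + 1) := by
    intro n
    have hu : ContDiffOn ℝ (N + 1) (iteratedDerivWithin k (f n) (Icc a b)) (Icc a b) := by
      have h := contDiffOn_iteratedDerivWithin hab k (N := N + 1) (hsm n (k + (N + 1)))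
      exact_mod_cast h
    have h := taylor_mean_remainder_bound (f := iteratedDerivWithin k (f n) (Icc a b)) (n := N) hab.le hu ht
      (fun y hy => by
        rw [Real.norm_eq_abs, iteratedDerivWithin_iteratedDerivWithin]
        exact hbd n (k + (N + 1)) y hy)
    rw [taylor_within_apply, Real.norm_eq_abs] at h
    have e : ∑ m ∈ Finset.range (N + 1), ((m ! : ℝ)⁻¹ * (t - a) ^ m) • iteratedDerivWithin m
        (iteratedDerivWithin k (f n) (Icc a b)) (Icc a b) a
        = ∑ m ∈ Finset.range (N + 1), iteratedDerivWithin (k + m) (f n) (Icc a b) a * (t - a) ^ m / m ! := by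
      refine Finset.sum_congr rfl fun m _ => ?_
      rw [smul_eq_mul, iteratedDerivWithin_iteratedDerivWithin]
      field_simp
    rw [e] at h
    have e2 : k + (N + 1) = k + N + 1 := by ring
    rw [e2] at h
    calc _ ≤ Mb (k + N + 1) * (t - a) ^ (N + 1) / N ! := h
      _ = Mb (k + N + 1) / N ! * (t - a) ^ (N + 1) := by ring
  have hlim : Tendsto (fun n => |iteratedDerivWithin k (f n) (Icc a b) t
      - ∑ m ∈ Finset.range (N + 1), iteratedDerivWithin (k + m) (f n) (Icc a b) a * (t - a) ^ m / (m ! : ℝ)|) atTop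
      (𝓝 |D k t - ∑ m ∈ Finset.range (N + 1), D (k + m) a * (t - a) ^ m / (m ! : ℝ)|) := by
    refine ((hDlim k t ht).sub (tendsto_finsetSum _ fun m _ => ?_)).abs
    exact ((hDlim (k + m) a ha).mul_const _).div_const _
  exact le_of_tendsto' hlim key

end

end Summit.QuantumFields.BalabanUV.Beta.EriceFlowEnclosureSmoothClauseCalc
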